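import Literature.NumberTheory.Transcendental.RoySmallValueStep2Orbit
import Literature.NumberTheory.Transcendental.RoySmallValueStep2Vanishing
import Literature.NumberTheory.Transcendental.RoySmallValueStep2Distances
import Literature.NumberTheory.Transcendental.RoySmallValueStep3Separation
import HarnessLib

/-!
# Roy's small value estimate for `𝔾ₐ × 𝔾ₘ` — §7 Step 2 at one level, packaged

Topic `Literature/NumberTheory/Transcendental`. Part of the formalisation of the proof of Roy 2013,
Theorem 1.1 (named fact `roy2013_thm_1_1`, `RoySmallValueEstimates.lean`), seat B. Source: D. Roy,
*A small value estimate for `𝔾ₐ × 𝔾ₘ`*, Mathematika 59 (2013) 333–363 = arXiv:1301.0663, §7,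
Step 2 (p. 18 of the arXiv text):

> [...] there exists a 0-dimensional subvariety `Z = Z_D` of `ℙ²_ℚ` contained in
> `𝒵(𝒟ⁱP̃_D ; 0 ≤ i < 2T)` such that `h_{𝒞_D}(Z) ≤ −(D^δ/25)(2D^β deg(Z) + D h(Z))` [...]
> `∑_{α∈𝒰} max{T log dist(α,(1:γ)), log dist(α,A_γ)} ≤ [...] ≤ −(D^δ/25)(D^β deg(Z) + D h(Z))`.

For a level package `L` with `P̃, Q ∈ 𝒞 = royBody D ξ η Y U T` this file COMBINES the orbit
selection (`exists_orbit_step2`), the vanishing of the integer forms of `𝒞` on the orbit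
(`aeval_eq_zero_of_orbit_prod_bound` + `orbit_condition_of_weights`) and the distance sum
(`step2_distance_sum`, with the positivity of the distances from `RoySmallValueZeroSeparation`
since `(ξ, η)` are not both algebraic) into one statement `LevelPkg.step2_level`: there is an orbit
`O = orb j₀` such that

1. every `R ∈ ℤ[X]_D` with `R ⊗ ℂ ∈ 𝒞` vanishes at all points of `O`;
2. `∑_{j∈O, u_j∈𝒰} max{T log d₁(u_j), log⁎ d₂(u_j)} ≤ (w/B) log ε − w − Y #O + Γ'' #O`,
   `w = Y #O + D (∑_{j∈O} h_K(rep j))/[K:ℚ]`, `ε = 2^{2k2^k} e^{−TU} N! (3e^Y)^N e^{YD²} < 1`.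

The extraction of the point `α₀` from (2) ("the set `𝒰` is not empty and contains at least one point
`α₀` for which `log dist(α₀,(1:γ)) ≤ −D^{δ+β}/(25T)`") is the elementary
`exists_close_point_of_sum_le`. All constants are symbolic; everything is proved; no definitions,
no named facts.

## References

* [Roy2013] D. Roy, *A small value estimate for 𝔾ₐ × 𝔾ₘ*, Mathematika 59 (2013), 333–363
  (arXiv:1301.0663), §7, Step 2; Propositions 2.4, 6.4.
-/

noncomputable section

open MvPolynomial Finset Height

namespace Literature.NumberTheory.Transcendental

namespace Roy2013

namespace LevelPkg

variable {D : ℕ} {Pt : MvPolynomial (Fin 3) ℤ} (L : LevelPkg D Pt)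

/-- The sup-normalised points of the package are at positive distance from `(1:γ)` when `(ξ, η)`
are not both algebraic. [cite: Roy2013, §7, Step 2 ("distinct from `(1:γ)`")] -/
theorem pdist_supNormalise_pos (hPt : (map (Int.castRingHom ℂ) Pt).IsHomogeneous D)
    (hPt0 : map (Int.castRingHom ℂ) Pt ≠ 0) {ξ η : ℂ} (hna : ¬(IsAlgebraic ℚ ξ ∧ IsAlgebraic ℚ η))
    (i : Fin L.m) : 0 < pdist ξ η (supNormalise (L.α i)) := by
  obtain ⟨ε, hε, hsep⟩ := exists_pdist_lower_bound hna (isHomogeneous_map_rat hPt)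
    (isHomogeneous_map_rat (isHomogeneous_map_levelQ hPt L.t))
    (by rw [toCX_map_int]; exact hPt0) (by rw [toCX_map_int]; exact L.hQ0)
    (by rw [toCX_map_int, toCX_map_int]; exact isRelPrime_of_regular hPt0 L.hPQ)
  refine lt_of_lt_of_le hε (hsep _ (norm_supNormalise (L.α_ne_zero i)) ?_ ?_)
  · rw [toCX_map_int, show (eval (supNormalise (L.α i)) (map (Int.castRingHom ℂ) Pt) : ℂ) =
      aeval (supNormalise (L.α i)) (map (Int.castRingHom ℂ) Pt) from rfl, supNormalise,
      aeval_smul_of_isHomogeneous hPt, show (aeval (L.α i) (map (Int.castRingHom ℂ) Pt) : ℂ) =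
      eval (L.α i) (map (Int.castRingHom ℂ) Pt) from rfl, (L.zero i).1, mul_zero]
  · rw [toCX_map_int, show (eval (supNormalise (L.α i)) (map (Int.castRingHom ℂ) (levelQ D Pt L.t)) : ℂ) =
      aeval (supNormalise (L.α i)) (map (Int.castRingHom ℂ) (levelQ D Pt L.t)) from rfl, supNormalise,
      aeval_smul_of_isHomogeneous (isHomogeneous_map_levelQ hPt L.t),
      show (aeval (L.α i) (map (Int.castRingHom ℂ) (levelQ D Pt L.t)) : ℂ) =
      eval (L.α i) (map (Int.castRingHom ℂ) (levelQ D Pt L.t)) from rfl, (L.zero i).2, mul_zero]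

/-- **Roy 2013, §7 Step 2 at one level.** See the module docstring. [cite: Roy2013, §7, Step 2] -/
theorem step2_level (hPt : (map (Int.castRingHom ℂ) Pt).IsHomogeneous D)
    (hPt0 : map (Int.castRingHom ℂ) Pt ≠ 0) {ξ η : ℂ} (hη : η ≠ 0)
    (hna : ¬(IsAlgebraic ℚ ξ ∧ IsAlgebraic ℚ η)) {T Li kr : ℕ} (hT₁ : (Li + 1).choose 2 < T)
    (hT₂ : T ≤ (Li + 2).choose 2) (h3L : 3 * (Li + 1) ≤ D) (hDT : D ≤ T)
    (hkr : 2 ^ kr * T ≤ 3 ^ kr * D) {Y U : ℝ} (hY0 : 0 < Y) (hU : 0 ≤ U)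
    (hYI : (3 * (1 + ‖ξ‖ + ‖η‖⁻¹)) ^ Li * (4 * (Li + 1) : ℝ) ^ (Li + 2).choose 2 ≤ Real.exp Y)
    (hPmem : map (Int.castRingHom ℂ) Pt ∈ royBody D ξ η Y U T)
    (hQmem : map (Int.castRingHom ℂ) (levelQ D Pt L.t) ∈ royBody D ξ η Y U T)
    {k : ℕ} (hk : D ^ 2 ≤ 2 ^ k) (K : IntermediateField ℚ ℂ) (hK : ∀ i k, L.α i k ∈ K)
    [Normal ℚ K] [NumberField K] {B : ℝ} (hB0 : 0 < B)
    (hB : Y * D ^ 2 + (∑ i, (L.e i : ℝ) * (D * logHeight ((L.cfg K hK).rep i))) /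
      Module.finrank ℚ K ≤ B)
    (hε : 2 ^ (2 * k * 2 ^ k) * (Real.exp (-(T * U)) *
        ((Fintype.card (PhiRow D)).factorial * (3 * Real.exp Y) ^ Fintype.card (PhiRow D))) *
        Real.exp (Y * D ^ 2) < 1) :
    ∃ j₀ : Fin L.m,
      (∀ R : MvPolynomial (Fin 3) ℤ, R.IsHomogeneous D →
        map (Int.castRingHom ℂ) R ∈ royBody D ξ η Y U T →
          ∀ j ∈ (L.cfg K hK).orb j₀, aeval (L.α j) (map (Int.castRingHom ℂ) R) = 0) ∧
      ∑ j ∈ ((L.cfg K hK).orb j₀).filter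
          (fun j => pdist ξ η (supNormalise (L.α j)) ≤ (2 * roy_c2 ξ η)⁻¹),
          max (T * Real.log (pdist ξ η (supNormalise (L.α j))))
            (if 0 < adist ξ η (supNormalise (L.α j)) then Real.log (adist ξ η (supNormalise (L.α j)))
              else T * Real.log (pdist ξ η (supNormalise (L.α j)))) ≤
        (Y * ((L.cfg K hK).orb j₀).card +
            D * (∑ j ∈ (L.cfg K hK).orb j₀, logHeight ((L.cfg K hK).rep j)) / Module.finrank ℚ K) / B *
          Real.log (2 ^ (2 * k * 2 ^ k) * (Real.exp (-(T * U)) *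
            ((Fintype.card (PhiRow D)).factorial * (3 * Real.exp Y) ^ Fintype.card (PhiRow D))) *
            Real.exp (Y * D ^ 2)) -
          (Y * ((L.cfg K hK).orb j₀).card +
            D * (∑ j ∈ (L.cfg K hK).orb j₀, logHeight ((L.cfg K hK).rep j)) / Module.finrank ℚ K) -
          Y * ((L.cfg K hK).orb j₀).card +
        max ((max (Real.log (2 ^ T * (3 * (3 * (1 + ‖ξ‖ + ‖η‖⁻¹) * max 1 (max ‖ξ‖ ‖η‖)) ^ T *
              (16 * (T : ℝ) ^ 3) ^ T) ^ kr))
            (Real.log (2 * ((2 * roy_c2 ξ η) ^ T * (1 + roy_c2 ξ η * Real.exp (1 + roy_c2 ξ η)) *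
              (3 * (3 * (1 + ‖ξ‖ + ‖η‖⁻¹) * max 1 (max ‖ξ‖ ‖η‖)) ^ T *
                (16 * (T : ℝ) ^ 3) ^ T) ^ kr))) +
          |Real.log (2 * (roy_c2 ξ η * Real.exp (roy_c2 ξ η) * (2 * roy_c2 ξ η ^ 2) ^ T))|))
          (Real.log (2 ^ T * (3 * (3 * (1 + ‖ξ‖ + ‖η‖⁻¹) * max 1 (max ‖ξ‖ ‖η‖)) ^ T *
              (16 * (T : ℝ) ^ 3) ^ T) ^ kr) - T * Real.log ((2 * roy_c2 ξ η)⁻¹)) *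
          ((L.cfg K hK).orb j₀).card := by
  classical
  -- the orbit (raw form)
  obtain ⟨j₀, hj₀⟩ := L.exists_orbit_step2 hPt hη hT₂ (by omega) hU hYI hPmem hQmem hk K hK hB0
    (Yw := Y) hB hε
  -- abbreviate `ε`
  obtain ⟨ε, hεdef⟩ : ∃ ε : ℝ, ε = 2 ^ (2 * k * 2 ^ k) * (Real.exp (-(T * U)) *
      ((Fintype.card (PhiRow D)).factorial * (3 * Real.exp Y) ^ Fintype.card (PhiRow D))) *
        Real.exp (Y * D ^ 2) := ⟨_, rfl⟩
  simp only [← hεdef] at hj₀ hε ⊢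
  have hε0 : 0 < ε := by rw [hεdef]; positivity
  have hn0 : (0 : ℝ) < Module.finrank ℚ K := by exact_mod_cast Module.finrank_pos
  -- the weights `E_j`, the exponent `w`
  obtain ⟨E, hE⟩ : ∃ E : Fin L.m → ℝ,
      E = fun j => Real.exp (Y + D * logHeight ((L.cfg K hK).rep j) / Module.finrank ℚ K) := ⟨_, rfl⟩
  have hEpos : ∀ j, 0 < E j := fun j => by rw [hE]; exact Real.exp_pos _
  obtain ⟨w, hw⟩ : ∃ w : ℝ, w = Y * ((L.cfg K hK).orb j₀).card +
      D * (∑ j ∈ (L.cfg K hK).orb j₀, logHeight ((L.cfg K hK).rep j)) / Module.finrank ℚ K := ⟨_, rfl⟩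
  have hw0 : 0 ≤ w := by
    rw [hw]
    exact add_nonneg (mul_nonneg hY0.le (Nat.cast_nonneg _))
      (div_nonneg (mul_nonneg (Nat.cast_nonneg _) (sum_nonneg fun j _ => logHeight_nonneg _)) hn0.le)
  have hO : ∀ t : Fin L.m → CX, (∀ j ∈ (L.cfg K hK).orb j₀, t j ∈ royBody D ξ η Y U T) →
      ∏ j ∈ (L.cfg K hK).orb j₀, (‖eval (L.α j) (t j)‖ / ‖L.α j‖ ^ D * E j) ≤ ε ^ (w / B) := by
    intro t ht
    rw [hE, hw]
    exact hj₀ t ht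
  refine ⟨j₀, ?_, ?_⟩
  · -- (1) vanishing of the integer forms of `𝒞`
    intro R hR hRmem
    have hOne : ((L.cfg K hK).orb j₀).Nonempty := ⟨j₀, (L.cfg K hK).self_mem_orb j₀⟩
    have hcond := orbit_condition_of_weights ((L.cfg K hK).orb j₀)
      (fun j => logHeight ((L.cfg K hK).rep j)) (D := (D : ℝ)) (Yw := Y)
      (n := (Module.finrank ℚ K : ℝ)) (ε := ε) (B := B) hε0 (Real.log_nonpos hε0.le hε.le)
      (mul_pos hY0 (by exact_mod_cast hOne.card_pos)) (by rw [← hw]; exact div_nonneg hw0 hB0.le)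
    have hO' : ∀ R' : CX, R' ∈ royBody D ξ η Y U T →
        ∏ j ∈ (L.cfg K hK).orb j₀, (‖aeval ((L.cfg K hK).α j) R'‖ / ‖(L.cfg K hK).α j‖ ^ D * E j) ≤
          ε ^ (w / B) := fun R' hR' => hO (fun _ => R') (fun _ _ => hR')
    have hX : (D : ℝ) * ((∑ j ∈ (L.cfg K hK).orb j₀, logHeight ((L.cfg K hK).rep j)) /
        Module.finrank ℚ K) + Real.log (ε ^ (w / B)) < ∑ j ∈ (L.cfg K hK).orb j₀, Real.log (E j) := by
      rw [hE, hw]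
      exact hcond
    exact (L.cfg K hK).aeval_eq_zero_of_orbit_prod_bound j₀ (fun R' => R' ∈ royBody D ξ η Y U T)
      hEpos hO' hX hR hRmem
  · -- (2) the distance sum
    have hd₁ : ∀ j ∈ (L.cfg K hK).orb j₀, 0 < pdist ξ η (supNormalise ((L.cfg K hK).α j)) :=
      fun j _ => L.pdist_supNormalise_pos hPt hPt0 hna j
    have hO' : ∀ t : Fin L.m → CX, (∀ j ∈ (L.cfg K hK).orb j₀, t j ∈ royBody D ξ η Y U T) →
        ∏ j ∈ (L.cfg K hK).orb j₀, (‖eval ((L.cfg K hK).α j) (t j)‖ / ‖(L.cfg K hK).α j‖ ^ D * E j) ≤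
          ε ^ (w / B) := hO
    have hdist := (L.cfg K hK).step2_distance_sum j₀ hη hT₁ hT₂ h3L hDT hkr Y U hEpos hO' hd₁
    have hlogM : Real.log (ε ^ (w / B)) = w / B * Real.log ε := Real.log_rpow hε0 _
    have hlogE : ∑ j ∈ (L.cfg K hK).orb j₀, Real.log (E j) = w := by
      rw [hE, hw]
      simp only [Real.log_exp]
      rw [sum_add_distrib, sum_const, nsmul_eq_mul, mul_sum, sum_div, mul_comm]
    rw [hlogM, hlogE, hw] at hdist
    exact hdist

end LevelPkg

/-- **Roy 2013, §7, Step 2 — the point `α₀`.** From the Step-2 distance inequality over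
`𝒰 ∩ O = {j ∈ O : p j}` in the shape `∑_{j ∈ 𝒰∩O} max(f_j, b_j) ≤ −M·d` with `#O ≤ d` (conclusion (2)
of `LevelPkg.step2_level` after bounding its right-hand side), some `j ∈ 𝒰 ∩ O` has `f_j ≤ −M`:
"In particular, the set `𝒰` is not empty and contains at least one point `α₀` for which
`log dist(α₀,(1:γ)) ≤ −D^{δ+β}/(25T)`" (p. 18). [cite: Roy2013, §7, Step 2] -/
theorem exists_close_point_of_sum_le {ι : Type*} (O : Finset ι) (p : ι → Prop) [DecidablePred p]
    (f b : ι → ℝ) {M d : ℝ} (hM : 0 < M) (hd0 : 0 < d) (hd : (O.card : ℝ) ≤ d)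
    (h : ∑ j ∈ O.filter p, max (f j) (b j) ≤ -(M * d)) : ∃ j ∈ O, p j ∧ f j ≤ -M := by
  have hcard : (((O.filter p).card : ℕ) : ℝ) ≤ d :=
    le_trans (by exact_mod_cast card_filter_le _ _) hd
  obtain ⟨j, hj, hle⟩ :=
    exists_le_of_sum_le_neg (O.filter p) (fun j => max (f j) (b j)) hM hd0 hcard h
  exact ⟨j, (mem_filter.mp hj).1, (mem_filter.mp hj).2, (le_max_left _ _).trans hle⟩

end Roy2013

end Literature.NumberTheory.Transcendental
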